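/-
Copyright (c) 2026 the pub-hodgecm-mathlib formalisation cell (harness21).  Prover seat hodgecm-mathlib-K2E3-p05 (g3), Track B «K2-LIT», engine E3, unit U4 «Keys»; PLACE-FREE LAYER
(`hd ↦ hϖ`) of ★ II-3 p856366 `K2E3IwahoriDetection`, ★ II-3′ p856454 `K2E3IwahoriCodetection`, ★ II-3″ p856542 `K2E3IwahoriLine` (g2); 2026-09-04.  KERNEL module: THEOREMS ONLY.
-/
import Summits.HodgeConjecture.HodgeConjecture.Theorems.K2E3IwahoriLine              -- ★ II-3″ p856542 (g2): the `hd`-free lemmas of II-3∕II-3′∕II-3″ (§1s: Jacquet-module algebra, `eA_mem_torusU_iff`, `exists_eq_smul_of_not_le`, …); brings their imports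
import Summits.HodgeConjecture.HodgeConjecture.Theorems.K2E3IwahoriLevelDatumPF      -- ★-filed p857019 (this seat): II-3-PF brick 2 (`exists_iwahoriDatum_iwahoriLevel` over `hϖ`)
import Summits.HodgeConjecture.HodgeConjecture.Theorems.K2E3PSIwahoriBasisPF         -- ★-filed (this seat): II-1-PF; brings ★ PS-LEVELS-PF p856999, ★ P1∕P2a PLACE-FREE
import HarnessLib

/-!
# K2 ∕ E3 «EllipticInputs», unit U4 «Keys» — Road II′ (TAME RAMIFIED places), PLACE-FREE LAYER II-3-PF «IWAHORI DETECTION, CODETECTION, THE IWAHORI LINE» at EVERY non-split `v`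
# (unramified OR ramified), over the uniformiser token `hϖ : |ϖ|_w = exp(−1)` alone   [Borel1976 §4; Casselman1980 §3; Casselman1995 Thm. 3.3.3; BruhatTits1972 (4.4.3)–(4.4.4)]

Cell hodgecm-mathlib (D-0151), FLOOR 0, Track B «K2-LIT», engine E3, crux item H413 = stmt-HodgeConjecture-24833 (route `HCCMUnconditional`, no route verbs); target BY NAME
`…K2E3EllipticInputs.U4Keys.sig_K2E3KeysThmTwoContracting` (U4-f), residue (R1) «ramified places» of MEMO v4 (Road II′).  Author K2E3-p05 (g3).  `--supports stmt-HodgeConjecture-24833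
--as helper`; THEOREMS ONLY.  The `hd`-dependent theorems of ★ II-3 `K2E3IwahoriDetection` (`exists_iwahoriDatum_K_zero_eq`, `exists_ne_zero_mem_inf_fixedPoints_I`), ★ II-3′
`K2E3IwahoriCodetection` (`not_fixedPoints_I_le`) and ★ II-3″ `K2E3IwahoriLine` (`exists_iwahoriLine`) with the unramified datum `hd` replaced by `hϖ` (they read `hd` only through
`hd.σσ`, `hd.vσ`, `hd.vϖ`; place-free ★ `galAdicCompletionMap_galAdicCompletionMap_of_smul_eq`, ★ `valued_galAdicCompletionMap`), proofs VERBATIM, cross-file calls re-pointed to the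
★ PF twins (II-1-PF, PS-LEVELS-PF, P1, II-3-PF brick 2); the `hd`-free lemmas are used from the ★ originals by name.  Output: the binders `u hu0 huN huI hline` of ★ p855172
`criterion_of_iwahoriLine` for a REGULAR unramified `i_G(χ)` at any non-split place.  See ★ II-3∕II-3′∕II-3″ for the mathematics (Borel's lemma both directions + plane geometry).
HONEST LABEL: HC_CM is proved only modulo the 7 printed citations (2 remaining named inputs: hLiu418 = stmt-HodgeConjecture-24832, h413 = stmt-HodgeConjecture-24833)
until rung 0 closes; count-neutral (place-free twin; the ★ II-3 files are NOT edited; no printed citation is discharged).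

## References
* [Borel1976] A. Borel, Invent. Math. 35 (1976), §4.  * [Casselman1980] W. Casselman, Compositio Math. 40 (1980), §3.  * [Casselman1995] notes (1995), §1.4, Thm. 3.3.3.
* [BruhatTits1972] F. Bruhat, J. Tits, Publ. Math. IHÉS 41 (1972), (4.4.3)–(4.4.4).  * [Rogawski1990] J. D. Rogawski, Ann. of Math. Stud. 123 (1990), §12.2 p. 173.
-/

set_option autoImplicit false
-- the mandated namespace has the single-problem summit's repeated segment (`HodgeConjecture.HodgeConjecture`)
set_option linter.dupNamespace false

noncomputable section

open NumberField IsDedekindDomain MeasureTheory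
open scoped Matrix MatrixGroups NNReal WithZero
open ValuativeRel
open Literature.NumberTheory Literature.NumberTheory.Automorphic Literature.NumberTheory.Automorphic.UnitaryGroup
open Literature.NumberTheory.Rogawski1990 Literature.NumberTheory.GaloisRepresentations
open Literature.RepresentationTheory.FiniteGroups Literature.RepresentationTheory.Semisimple

namespace Summit.HodgeConjecture.HodgeConjecture.Cruxes.H413.K2E3IwahoriLinePF

open Summit.HodgeConjecture.HodgeConjecture.Cruxes.H413
open Summit.HodgeConjecture.HodgeConjecture.Cruxes.H413.F0P3cStCharTSStLevelsTransport
open Summit.HodgeConjecture.HodgeConjecture.Cruxes.H413.K2E3IwahoriLevelDatum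
open Summit.HodgeConjecture.HodgeConjecture.Cruxes.H413.K2E3PSRegularReducibleCompZero
open Summit.HodgeConjecture.HodgeConjecture.Cruxes.H413.K2E3IwahoriDetection
open Summit.HodgeConjecture.HodgeConjecture.Cruxes.H413.K2E3IwahoriCodetection
open Summit.HodgeConjecture.HodgeConjecture.Cruxes.H413.K2E3IwahoriLine
open F0P2pCmPrincipalSeriesInterface

variable (L : Type) [Field L] [NumberField L] [IsCMField L] (v : HeightOneSpectrum (𝓞 ↥(maximalRealSubfield L)))
  (w : PlacesOver L v) (hw : IsCMField.complexConj L • w.1 = w.1)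
  (eA : Gqs L v ≃ₜ* ↥(unitaryGroupOfForm (galAdicCompletionMap (L := L) (IsCMField.complexConj L) hw) ((StdForm.antidiagonal 3).over (w.1.adicCompletion L))))
  (heA : ∀ g : Gqs L v,
    ((eA g : ↥(unitaryGroupOfForm (galAdicCompletionMap (L := L) (IsCMField.complexConj L) hw) ((StdForm.antidiagonal 3).over (w.1.adicCompletion L)))) : GL (Fin 3) (w.1.adicCompletion L)) =
      ((localNonsplitEquiv (IsCMField.complexConj L) (qsForm L) (IsCMField.complexConj_ne_one L) w hw g :
        ↥(unitaryGroupOfForm (galAdicCompletionMap (L := L) (IsCMField.complexConj L) hw) (placeForm (qsForm L) w.1))) : GL (Fin 3) (w.1.adicCompletion L)))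

include heA in
set_option maxHeartbeats 1600000 in
-- the ray data and the transport clauses (class of ★ `F0P3CMBorelIwahoriDatum` §2)
/-- **An Iwahori datum for `cmBorelTriple L 3 v` WITH FIRST LEVEL `I`** (`v` inert, the (G3)-EXPLICIT levels): the model datum ★-filed `K2E3IwahoriLevelDatumPF.exists_iwahoriDatum_iwahoriLevel` along the ray
`d(ϖ, 1, (σϖ)⁻¹)` (★ `exists_coe_eq_diag`), pulled back along `eA` by ★ `StructureTransport.exists_iwahoriDatum_comap` (clauses `T′.comap eA = T`, `N′.comap eA = N` above).
[cite: Casselman1995, Prop. 1.4.4, Thm. 3.3.3] [cite: PlatonovRapinchuk1994, §5.1] -/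
theorem exists_iwahoriDatum_K_zero_eq {ϖ : w.1.adicCompletion L}
    (hϖ : Valued.v ϖ = WithZero.exp (-1 : ℤ))
    (g₁ : GL (Fin 3) (w.1.adicCompletion L)) (hg₁ : (g₁ : Matrix (Fin 3) (Fin 3) (w.1.adicCompletion L)) = Matrix.diagonal ![(1 : w.1.adicCompletion L), 1, ϖ])
    (K0 K1 I : Subgroup (Gqs L v))
    (hK0 : K0 = ((glInt 3 (w.1.adicCompletion L)).subgroupOf
      (unitaryGroupOfForm (galAdicCompletionMap (L := L) (IsCMField.complexConj L) hw) ((StdForm.antidiagonal 3).over (w.1.adicCompletion L)))).comap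
        eA.toMulEquiv.toMonoidHom)
    (hK1 : K1 = (((glInt 3 (w.1.adicCompletion L)).map (MulAut.conj g₁).toMonoidHom).subgroupOf
      (unitaryGroupOfForm (galAdicCompletionMap (L := L) (IsCMField.complexConj L) hw) ((StdForm.antidiagonal 3).over (w.1.adicCompletion L)))).comap
        eA.toMulEquiv.toMonoidHom)
    (hI : I = K0 ⊓ K1) :
    ∃ 𝓘 : (cmBorelTriple L 3 v).IwahoriDatum, 𝓘.K 0 = I := by
  have hσσ := (galAdicCompletionMap_galAdicCompletionMap_of_smul_eq (IsCMField.complexConj L) w (IsCMField.complexConj_ne_one L) hw)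
  have hϖ0 : ϖ ≠ 0 := CartanUnique.uniformizer_ne_zero hϖ
  have hσϖ0 : galAdicCompletionMap (L := L) (IsCMField.complexConj L) hw ϖ ≠ 0 := (map_ne_zero _).2 hϖ0
  -- the ray `s = d(ϖ, 1, (σϖ)⁻¹)` and its ratio data
  obtain ⟨s, -, hs⟩ := exists_coe_eq_diag (galAdicCompletionMap (L := L) (IsCMField.complexConj L) hw)
    (rfl : (StdForm.antidiagonal 3).over (w.1.adicCompletion L) = _) hσσ hϖ0 (β := 1) (by rw [map_one, mul_one])
  have hvσϖ : valuation (w.1.adicCompletion L) (galAdicCompletionMap (L := L) (IsCMField.complexConj L) hw ϖ) = valuation (w.1.adicCompletion L) ϖ :=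
    (v_eq_iff_valuation_eq _ _).1 ((fun a => valued_galAdicCompletionMap (L := L) (IsCMField.complexConj L) hw a) ϖ)
  have hq0 : valuation (w.1.adicCompletion L) ϖ ≠ 0 := (Valuation.ne_zero_iff _).2 hϖ0
  have hq1 : valuation (w.1.adicCompletion L) ϖ < 1 := by
    rw [← v_lt_one_iff_valuation_lt_one, hϖ, ← WithZero.exp_zero, WithZero.exp_lt_exp]; norm_num
  set u : Fin 3 → (w.1.adicCompletion L)ˣ := ![Units.mk0 ϖ hϖ0, 1, (Units.mk0 _ hσϖ0)⁻¹] with hu_def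
  have hu0 : ((u 0 : (w.1.adicCompletion L)ˣ) : w.1.adicCompletion L) = ϖ := by simp only [hu_def, Matrix.cons_val_zero, Units.val_mk0]
  have hu1 : ((u 1 : (w.1.adicCompletion L)ˣ) : w.1.adicCompletion L) = 1 := by simp only [hu_def, Matrix.cons_val_one, Matrix.cons_val_zero, Units.val_one]
  have hu2 : ((u 2 : (w.1.adicCompletion L)ˣ) : w.1.adicCompletion L) = (galAdicCompletionMap (L := L) (IsCMField.complexConj L) hw ϖ)⁻¹ := by
    simp only [hu_def, Matrix.cons_val_two, Matrix.tail_cons, Matrix.head_cons, Units.val_inv_eq_inv_val, Units.val_mk0]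
  have hsu : ((s : ↥(unitaryGroupOfForm (galAdicCompletionMap (L := L) (IsCMField.complexConj L) hw) ((StdForm.antidiagonal 3).over (w.1.adicCompletion L)))) :
      GL (Fin 3) (w.1.adicCompletion L)) = glDiagonal 3 (w.1.adicCompletion L) u := by
    refine Units.ext ?_
    rw [hs, coe_glDiagonal]
    ext i j
    fin_cases i <;> fin_cases j <;> simp [hu0, hu1, hu2, Matrix.diagonal]
  have hu : ∀ i j : Fin 3, i < j → valuation (w.1.adicCompletion L) ((u i : w.1.adicCompletion L) * ((u j : w.1.adicCompletion L))⁻¹) ≤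
      valuation (w.1.adicCompletion L) ϖ := by
    intro i j hij
    fin_cases i <;> fin_cases j
    all_goals first | exact absurd hij (by decide) | skip
    · show valuation _ (((u 0 : (w.1.adicCompletion L)ˣ) : w.1.adicCompletion L) * (((u 1 : (w.1.adicCompletion L)ˣ) : w.1.adicCompletion L))⁻¹) ≤ _
      rw [hu0, hu1, inv_one, mul_one]
    · show valuation _ (((u 0 : (w.1.adicCompletion L)ˣ) : w.1.adicCompletion L) * (((u 2 : (w.1.adicCompletion L)ˣ) : w.1.adicCompletion L))⁻¹) ≤ _
      rw [hu0, hu2, inv_inv, map_mul, hvσϖ]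
      calc valuation _ ϖ * valuation _ ϖ ≤ valuation _ ϖ * 1 := mul_le_mul' le_rfl hq1.le
        _ = valuation _ ϖ := mul_one _
    · show valuation _ (((u 1 : (w.1.adicCompletion L)ˣ) : w.1.adicCompletion L) * (((u 2 : (w.1.adicCompletion L)ˣ) : w.1.adicCompletion L))⁻¹) ≤ _
      rw [hu1, hu2, inv_inv, one_mul, hvσϖ]
  -- the model datum at level `I`
  obtain ⟨𝓘', -, -, hK0', -⟩ := K2E3IwahoriLevelDatumPF.exists_iwahoriDatum_iwahoriLevel L v w hw hϖ g₁ hg₁ hq0 hq1 s u hsu hu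
  -- the transport clauses
  have hM : ((borelTriple (galAdicCompletionMap (L := L) (IsCMField.complexConj L) hw) ((StdForm.antidiagonal 3).over (w.1.adicCompletion L)) rfl).M).comap
      (eA : Gqs L v →* ↥(unitaryGroupOfForm (galAdicCompletionMap (L := L) (IsCMField.complexConj L) hw) ((StdForm.antidiagonal 3).over (w.1.adicCompletion L)))) =
      (cmBorelTriple L 3 v).M := by
    ext g
    rw [Subgroup.mem_comap, borelTriple_M]
    exact eA_mem_torusU_iff L v w hw eA heA g
  have hN : ((borelTriple (galAdicCompletionMap (L := L) (IsCMField.complexConj L) hw) ((StdForm.antidiagonal 3).over (w.1.adicCompletion L)) rfl).N).comap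
      (eA : Gqs L v →* ↥(unitaryGroupOfForm (galAdicCompletionMap (L := L) (IsCMField.complexConj L) hw) ((StdForm.antidiagonal 3).over (w.1.adicCompletion L)))) =
      (cmBorelTriple L 3 v).N := by
    ext g
    rw [Subgroup.mem_comap, borelTriple_N]
    exact eA_mem_unipotentU_iff L v w hw eA heA g
  obtain ⟨𝓘, -, -, hK⟩ := StructureTransport.exists_iwahoriDatum_comap eA (cmBorelTriple L 3 v)
    (borelTriple (galAdicCompletionMap (L := L) (IsCMField.complexConj L) hw) ((StdForm.antidiagonal 3).over (w.1.adicCompletion L)) rfl) hM hN 𝓘'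
  refine ⟨𝓘, ?_⟩
  rw [hK 0, hK0', hI, hK0, hK1, ← Subgroup.comap_inf]
  rfl

include heA in
set_option maxHeartbeats 8000000 in
set_option synthInstance.maxHeartbeats 400000 in
-- statement∕proof-heavy: the `SmoothInd` carrier of `cmPrincipalSeries`, ★ N1's datum and the Jacquet line of a subrepresentation (class of ★ p855058 §3)
/-- **IWAHORI DETECTION (Borel's lemma, sub direction) for the unramified principal series of `U(Φ₃)(L⁺_v)`, `v` inert.**  `χ = (χ₁, χ₂)` continuous and UNRAMIFIED (`χ ≡ 1` on `T ∩ K_v`),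
`⊥ ≠ N ≠ ⊤` a `G`-stable subspace of `V = i_G(χ)`: there is `0 ≠ u ∈ N` fixed by the Iwahori subgroup `I` — so `N ∩ V^I` is a non-zero subspace of the Iwahori plane `ℂ f₁ ⊕ ℂ f_w` (★ II-1).
Proof in the module docstring: `r_B N` is a `χ`-line, `T ∩ I` acts trivially on it, Jacquet's lemma at the level `I`. [cite: Borel1976, Lemma 4.7] [cite: Casselman1995, Thm. 3.3.3, Prop. 7.1.3]
[cite: Casselman1980, §2] [cite: BernsteinZelevinsky1977, Prop. 1.9 (b)] -/
theorem exists_ne_zero_mem_inf_fixedPoints_I (hns : ∀ w' : PlacesOver L v, IsCMField.complexConj L • w'.1 = w'.1) {ϖ : w.1.adicCompletion L}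
    (hϖ : Valued.v ϖ = WithZero.exp (-1 : ℤ))
    (g₁ : GL (Fin 3) (w.1.adicCompletion L)) (hg₁ : (g₁ : Matrix (Fin 3) (Fin 3) (w.1.adicCompletion L)) = Matrix.diagonal ![(1 : w.1.adicCompletion L), 1, ϖ])
    (K0 K1 I : Subgroup (Gqs L v))
    (hK0 : K0 = ((glInt 3 (w.1.adicCompletion L)).subgroupOf
      (unitaryGroupOfForm (galAdicCompletionMap (L := L) (IsCMField.complexConj L) hw) ((StdForm.antidiagonal 3).over (w.1.adicCompletion L)))).comap
        eA.toMulEquiv.toMonoidHom)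
    (hK1 : K1 = (((glInt 3 (w.1.adicCompletion L)).map (MulAut.conj g₁).toMonoidHom).subgroupOf
      (unitaryGroupOfForm (galAdicCompletionMap (L := L) (IsCMField.complexConj L) hw) ((StdForm.antidiagonal 3).over (w.1.adicCompletion L)))).comap
        eA.toMulEquiv.toMonoidHom)
    (hI : I = K0 ⊓ K1)
    (χ₁ : (LocalRing L v)ˣ →* ℂˣ) (χ₂ : ↥(normOneUnits (conjLocal L (IsCMField.complexConj L) v)) →* ℂˣ)
    (h₁ : Continuous fun x => ((χ₁ x : ℂˣ) : ℂ)) (h₂ : Continuous fun x => ((χ₂ x : ℂˣ) : ℂ))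
    (hU : ∀ t : ↥(torusU (conjLocal L (IsCMField.complexConj L) v) (cmLocalForm L 3 v)),
      (t : ↥(unitaryGroupOfForm (conjLocal L (IsCMField.complexConj L) v) (cmLocalForm L 3 v))) ∈ cmLocalIntegralLevel L 3 (qsForm L) v → cmTorusCharPair L v χ₁ χ₂ t = 1)
    (N : Subrepresentation (cmPrincipalSeries L 3 v (cmTorusCharPair L v χ₁ χ₂))) (hbot : N ≠ ⊥) (htop : N ≠ ⊤) :
    haveI := locallyCompactSpace_cmBorelU L 3 v
    ∃ u : Representation.SmoothInd (cmBorelTriple L 3 v).P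
        (Representation.twist (((Representation.trivial ℂ ↥(torusU (conjLocal L (IsCMField.complexConj L) v) (cmLocalForm L 3 v)) ℂ).twist (cmTorusCharPair L v χ₁ χ₂)).comp
          (cmBorelTriple L 3 v).proj) (rootDeltaChar (cmBorelTriple L 3 v).P)),
      u ∈ N.toSubmodule ∧ u ∈ (cmPrincipalSeries L 3 v (cmTorusCharPair L v χ₁ χ₂)).fixedPoints I ∧ u ≠ 0 := by
  haveI := locallyCompactSpace_cmBorelU L 3 v
  -- the datum with `K 0 = I`
  obtain ⟨𝓘, h𝓘⟩ := K2E3IwahoriLinePF.exists_iwahoriDatum_K_zero_eq L v w hw eA heA hϖ g₁ hg₁ K0 K1 I hK0 hK1 hI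
  -- ★ N1: `r_B V` is a plane; smoothness; «no constituent has `r = 0`»
  obtain ⟨hfd, hX2, -⟩ := (UnitaryGroup.U3PrincipalSeriesJacquetFiltration_iff L).1
    (F0P3U3PrincipalSeriesJacquetFiltrationHolds.U3PrincipalSeriesJacquetFiltration_holds L) v hns χ₁ χ₂ h₁ h₂
  haveI := hfd
  have hsm : (cmPrincipalSeries L 3 v (cmTorusCharPair L v χ₁ χ₂)).IsSmooth := isSmooth_cmPrincipalSeries L v _
  have h1 : Module.finrank ℂ ((cmBorelTriple L 3 v).restrict N.toRepresentation).Coinvariants = 1 :=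
    Representation.finrank_coinvariants_eq_one_of_ne_bot_of_ne_top (cmBorelTriple L 3 v) (isLimitOfCompactOpen_cmBorelTriple_N L 3 v) hsm
      (fun c hc => by
        obtain ⟨r, rfl⟩ := IrrClass.mk_surjective c
        exact ⟨r, rfl, not_subsingleton_iff_nontrivial.mp fun h0 =>
          not_subsingleton_coinvariants_of_isConstituentOf_cmPrincipalSeries L v u3_isSupercuspidal_iff_jacquet_eq_zero_holds hns _ r hc h0⟩)
      hX2 hbot htop
  -- `T` acts on the line `r_B N` by `χ` (Frobenius), hence `T ∩ I` acts trivially in the unnormalised Jacquet module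
  have hJ := normalizedJacquet_apply_eq_smul_of_finrank_eq_one_of_intertwiningMap_cmPrincipalSeries L v _ _
    (hsm.toRepresentation N) h1 (Subrepresentation.subtypeIntertwiningMap N) (Subrepresentation.subtypeIntertwiningMap_ne_zero hbot)
  have hlev := isOpen_isCompact_levels L v w hw eA g₁ K0 K1 I hK0 hK1 hI
  have hIc : IsCompact (I : Set (Gqs L v)) := hlev.2.2.2
  have hfix := jacquetModule_apply_eq_self_of_normalizedJacquet_eq_smul (cmBorelTriple L 3 v) N.toRepresentation I (cmTorusCharPair L v χ₁ χ₂) hJ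
    (fun m hm => hU m ((mem_K0_iff_mem_integralLevel L v w hw eA heA K0 hK0 _).1 (I_le_K0 L v K0 K1 I hI hm)))
    (fun m hm => rootDeltaChar_borel_eq_one_of_mem_isCompact _ _ (cmLocalForm_eq_over L 3 v) hIc _ hm)
  -- admissibility of `N` and Jacquet's lemma at the Iwahori level
  have hadm := (isAdmissible_cmPrincipalSeries_of_iwasawa L 3 v (exists_borel_mul_mem_cmLocalIntegralLevel L 3 v)
    (cmTorusCharPair L v χ₁ χ₂)).toRepresentation N
  have key := exists_mem_fixedPoints_ne_zero_of_finrank_coinvariants_eq_one (cmBorelTriple L 3 v) 𝓘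
    (cmPrincipalSeries L 3 v (cmTorusCharPair L v χ₁ χ₂)) N hadm h1 (fun m hm => hfix m (h𝓘 ▸ hm))
  rw [h𝓘] at key
  exact key

include heA in
set_option maxHeartbeats 8000000 in
set_option synthInstance.maxHeartbeats 400000 in
-- statement∕proof-heavy: the `SmoothInd` carrier of `cmPrincipalSeries` and ★ N1's datum; the proof is §2 fed term-for-term (class of ★ p855058 §3, ★-filed II-3 §3)
/-- **IWAHORI CODETECTION (Borel's lemma, quotient direction) for the regular unramified principal series of `U(Φ₃)(L⁺_v)`, `v` inert**: for `χ = (χ₁, χ₂)` continuous, REGULAR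
(`χ ≠ wχ = (χ̄₁⁻¹, χ₂)`), with `χ` AND `wχ` trivial on `T ∩ K_v`, and a `G`-stable `N ≠ ⊤` of `V = i_G(χ)`: the Iwahori plane `V^I` is NOT contained in `N`.  ★ N1 gives the `wχ`-line of
`r_B V`; regularity gives `m₀`; for `m₁ ∈ T ∩ I ⊆ T ∩ K_v` (★ FILE C `mem_K0_iff_mem_integralLevel`) `χ(m₁) = wχ(m₁) = 1` and `δ_B^{1∕2}(m₁) = 1` (`I` compact); `T` is abelian (★
`torusU_mul_comm`); §2 with the datum ★-filed `exists_iwahoriDatum_K_zero_eq` (`K 0 = I`), ★ `isAdmissible_cmPrincipalSeries_of_iwasawa`, ★ `isLimitOfCompactOpen_cmBorelTriple_N` and «no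
constituent has `r = 0`» (★ N6).  With ★-filed II-3 (`N ∩ V^I ≠ 0`) this makes `N ∩ V^I` a LINE — the `hline` of ★ p855172. [cite: Borel1976, Lemma 4.7] [cite: Casselman1995, Thm. 3.3.3, L. 7.1.1]
[cite: Keys1984, §3, §7] -/
theorem not_fixedPoints_I_le (hns : ∀ w' : PlacesOver L v, IsCMField.complexConj L • w'.1 = w'.1) {ϖ : w.1.adicCompletion L}
    (hϖ : Valued.v ϖ = WithZero.exp (-1 : ℤ))
    (g₁ : GL (Fin 3) (w.1.adicCompletion L)) (hg₁ : (g₁ : Matrix (Fin 3) (Fin 3) (w.1.adicCompletion L)) = Matrix.diagonal ![(1 : w.1.adicCompletion L), 1, ϖ])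
    (K0 K1 I : Subgroup (Gqs L v))
    (hK0 : K0 = ((glInt 3 (w.1.adicCompletion L)).subgroupOf
      (unitaryGroupOfForm (galAdicCompletionMap (L := L) (IsCMField.complexConj L) hw) ((StdForm.antidiagonal 3).over (w.1.adicCompletion L)))).comap
        eA.toMulEquiv.toMonoidHom)
    (hK1 : K1 = (((glInt 3 (w.1.adicCompletion L)).map (MulAut.conj g₁).toMonoidHom).subgroupOf
      (unitaryGroupOfForm (galAdicCompletionMap (L := L) (IsCMField.complexConj L) hw) ((StdForm.antidiagonal 3).over (w.1.adicCompletion L)))).comap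
        eA.toMulEquiv.toMonoidHom)
    (hI : I = K0 ⊓ K1)
    (χ₁ : (LocalRing L v)ˣ →* ℂˣ) (χ₂ : ↥(normOneUnits (conjLocal L (IsCMField.complexConj L) v)) →* ℂˣ)
    (h₁ : Continuous fun x => ((χ₁ x : ℂˣ) : ℂ)) (h₂ : Continuous fun x => ((χ₂ x : ℂˣ) : ℂ))
    (hreg : cmTorusCharPair L v χ₁ χ₂ ≠ cmTorusCharPair L v (conjInvChar (conjLocal L (IsCMField.complexConj L) v) χ₁) χ₂)
    (hU : ∀ t : ↥(torusU (conjLocal L (IsCMField.complexConj L) v) (cmLocalForm L 3 v)),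
      (t : ↥(unitaryGroupOfForm (conjLocal L (IsCMField.complexConj L) v) (cmLocalForm L 3 v))) ∈ cmLocalIntegralLevel L 3 (qsForm L) v → cmTorusCharPair L v χ₁ χ₂ t = 1)
    (hUw : ∀ t : ↥(torusU (conjLocal L (IsCMField.complexConj L) v) (cmLocalForm L 3 v)),
      (t : ↥(unitaryGroupOfForm (conjLocal L (IsCMField.complexConj L) v) (cmLocalForm L 3 v))) ∈ cmLocalIntegralLevel L 3 (qsForm L) v →
        cmTorusCharPair L v (conjInvChar (conjLocal L (IsCMField.complexConj L) v) χ₁) χ₂ t = 1)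
    (N : Subrepresentation (cmPrincipalSeries L 3 v (cmTorusCharPair L v χ₁ χ₂))) (htop : N ≠ ⊤) :
    ¬ ((cmPrincipalSeries L 3 v (cmTorusCharPair L v χ₁ χ₂)).fixedPoints I ≤ N.toSubmodule) := by
  haveI := locallyCompactSpace_cmBorelU L 3 v
  -- the datum with `K 0 = I`
  obtain ⟨𝓘, h𝓘⟩ := K2E3IwahoriLinePF.exists_iwahoriDatum_K_zero_eq L v w hw eA heA hϖ g₁ hg₁ K0 K1 I hK0 hK1 hI
  -- ★ N1 (all three conjuncts), smoothness, admissibility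
  obtain ⟨hfd, hX2, hJ⟩ := (UnitaryGroup.U3PrincipalSeriesJacquetFiltration_iff L).1
    (F0P3U3PrincipalSeriesJacquetFiltrationHolds.U3PrincipalSeriesJacquetFiltration_holds L) v hns χ₁ χ₂ h₁ h₂
  have hsm : (cmPrincipalSeries L 3 v (cmTorusCharPair L v χ₁ χ₂)).IsSmooth := isSmooth_cmPrincipalSeries L v _
  have hadm := isAdmissible_cmPrincipalSeries_of_iwasawa L 3 v (exists_borel_mul_mem_cmLocalIntegralLevel L 3 v) (cmTorusCharPair L v χ₁ χ₂)
  have hlev := isOpen_isCompact_levels L v w hw eA g₁ K0 K1 I hK0 hK1 hI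
  have hIc : IsCompact (I : Set (Gqs L v)) := hlev.2.2.2
  -- a regular witness `m₀`
  obtain ⟨m₀, hm₀⟩ : ∃ m₀ : ↥(torusU (conjLocal L (IsCMField.complexConj L) v) (cmLocalForm L 3 v)),
      ((cmWeylTorusCharPair L v χ₁ χ₂ m₀ : ℂˣ) : ℂ) ≠ ((cmTorusCharPair L v χ₁ χ₂ m₀ : ℂˣ) : ℂ) := by
    by_contra hall
    push Not at hall
    exact hreg (MonoidHom.ext fun m => (Units.ext (hall m)).symm)
  -- `m₁ ∈ T ∩ I` lies in `K_v`
  have hKv : ∀ m₁ : ↥(torusU (conjLocal L (IsCMField.complexConj L) v) (cmLocalForm L 3 v)),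
      (m₁ : ↥(unitaryGroupOfForm (conjLocal L (IsCMField.complexConj L) v) (cmLocalForm L 3 v))) ∈ I →
      (m₁ : ↥(unitaryGroupOfForm (conjLocal L (IsCMField.complexConj L) v) (cmLocalForm L 3 v))) ∈ cmLocalIntegralLevel L 3 (qsForm L) v :=
    fun m₁ hm₁ => (mem_K0_iff_mem_integralLevel L v w hw eA heA K0 hK0 _).1 (I_le_K0 L v K0 K1 I hI hm₁)
  -- `T ∩ I` fixes the normalised, hence the unnormalised, Jacquet module
  have hnorm := fun (m₁ : ↥(torusU (conjLocal L (IsCMField.complexConj L) v) (cmLocalForm L 3 v)))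
      (hm₁ : (m₁ : ↥(unitaryGroupOfForm (conjLocal L (IsCMField.complexConj L) v) (cmLocalForm L 3 v))) ∈ I) =>
    normalizedJacquet_apply_eq_self_of_lineDatum (cmBorelTriple L 3 v) (cmPrincipalSeries L 3 v (cmTorusCharPair L v χ₁ χ₂))
      (cmTorusCharPair L v χ₁ χ₂) (cmWeylTorusCharPair L v χ₁ χ₂) hJ m₀ hm₀ m₁ (hU m₁ (hKv m₁ hm₁)) (hUw m₁ (hKv m₁ hm₁))
      (torusU_mul_comm (conjLocal L (IsCMField.complexConj L) v) (cmLocalForm L 3 v) m₀ m₁)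
  have hfix := jacquetModule_apply_eq_self_of_normalizedJacquet_eq_self (cmBorelTriple L 3 v) (cmPrincipalSeries L 3 v (cmTorusCharPair L v χ₁ χ₂)) I
    hnorm (fun m hm => rootDeltaChar_borel_eq_one_of_mem_isCompact _ _ (cmLocalForm_eq_over L 3 v) hIc _ hm)
  -- §2
  have key := not_fixedPoints_le_of_jacquet_trivial (cmBorelTriple L 3 v) 𝓘 (cmPrincipalSeries L 3 v (cmTorusCharPair L v χ₁ χ₂)) hadm hsm
    (isLimitOfCompactOpen_cmBorelTriple_N L 3 v)
    (fun c hc => by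
      obtain ⟨r, rfl⟩ := IrrClass.mk_surjective c
      exact ⟨r, rfl, not_subsingleton_iff_nontrivial.mp fun h0 =>
        not_subsingleton_coinvariants_of_isConstituentOf_cmPrincipalSeries L v u3_isSupercuspidal_iff_jacquet_eq_zero_holds hns _ r hc h0⟩)
    (fun m hm => hfix m (h𝓘 ▸ hm)) N htop
  rw [h𝓘] at key
  exact key

include heA in
set_option maxHeartbeats 12000000 in
set_option synthInstance.maxHeartbeats 400000 in
-- statement∕proof-heavy: the `SmoothInd` carrier of `cmPrincipalSeries` (class of ★ II-1 §3 ∕ ★ II-2a §3)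
/-- **THE IWAHORI LINE.**  `v` inert ((G3)-EXPLICIT letters), `χ = (χ₁, χ₂)` continuous, REGULAR, `χ` and `wχ` trivial on `T ∩ K_v`, `(f₁, f_w)` the Iwahori pair of ★ II-1, `⊥ ≠ N ≠ ⊤` a `G`-stable subspace
of `i_G(χ)`: there is `u ≠ 0` in `N ∩ (ℂ f₁ ⊕ ℂ f_w)` such that every vector of `N ∩ (ℂ f₁ ⊕ ℂ f_w)` is a multiple of `u` — ★ II-3 + ★-filed II-3′ + ★ II-1 + §1.  The binders
`u hu0 huN huI hline` of ★ p855172 `criterion_of_iwahoriLine`. [cite: Borel1976, §4] [cite: Casselman1980, §3] -/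
theorem exists_iwahoriLine (hns : ∀ w' : PlacesOver L v, IsCMField.complexConj L • w'.1 = w'.1) {ϖ : w.1.adicCompletion L}
    (hϖ : Valued.v ϖ = WithZero.exp (-1 : ℤ))
    (g₁ : GL (Fin 3) (w.1.adicCompletion L)) (hg₁ : (g₁ : Matrix (Fin 3) (Fin 3) (w.1.adicCompletion L)) = Matrix.diagonal ![(1 : w.1.adicCompletion L), 1, ϖ])
    (K0 K1 I : Subgroup (Gqs L v))
    (hK0 : K0 = ((glInt 3 (w.1.adicCompletion L)).subgroupOf
      (unitaryGroupOfForm (galAdicCompletionMap (L := L) (IsCMField.complexConj L) hw) ((StdForm.antidiagonal 3).over (w.1.adicCompletion L)))).comap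
        eA.toMulEquiv.toMonoidHom)
    (hK1 : K1 = (((glInt 3 (w.1.adicCompletion L)).map (MulAut.conj g₁).toMonoidHom).subgroupOf
      (unitaryGroupOfForm (galAdicCompletionMap (L := L) (IsCMField.complexConj L) hw) ((StdForm.antidiagonal 3).over (w.1.adicCompletion L)))).comap
        eA.toMulEquiv.toMonoidHom)
    (hI : I = K0 ⊓ K1)
    (χ₁ : (LocalRing L v)ˣ →* ℂˣ) (χ₂ : ↥(normOneUnits (conjLocal L (IsCMField.complexConj L) v)) →* ℂˣ)
    (h₁ : Continuous fun x => ((χ₁ x : ℂˣ) : ℂ)) (h₂ : Continuous fun x => ((χ₂ x : ℂˣ) : ℂ))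
    (hreg : cmTorusCharPair L v χ₁ χ₂ ≠ cmTorusCharPair L v (conjInvChar (conjLocal L (IsCMField.complexConj L) v) χ₁) χ₂)
    (hU : ∀ t : ↥(torusU (conjLocal L (IsCMField.complexConj L) v) (cmLocalForm L 3 v)),
      (t : ↥(unitaryGroupOfForm (conjLocal L (IsCMField.complexConj L) v) (cmLocalForm L 3 v))) ∈ cmLocalIntegralLevel L 3 (qsForm L) v → cmTorusCharPair L v χ₁ χ₂ t = 1)
    (hUw : ∀ t : ↥(torusU (conjLocal L (IsCMField.complexConj L) v) (cmLocalForm L 3 v)),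
      (t : ↥(unitaryGroupOfForm (conjLocal L (IsCMField.complexConj L) v) (cmLocalForm L 3 v))) ∈ cmLocalIntegralLevel L 3 (qsForm L) v →
        cmTorusCharPair L v (conjInvChar (conjLocal L (IsCMField.complexConj L) v) χ₁) χ₂ t = 1)
    (N : Subrepresentation (cmPrincipalSeries L 3 v (cmTorusCharPair L v χ₁ χ₂))) (hbot : N ≠ ⊥) (htop : N ≠ ⊤) :
    haveI := locallyCompactSpace_cmBorelU L 3 v
    ∀ (f₁ f_w : Representation.SmoothInd (cmBorelTriple L 3 v).P
        (Representation.twist (((Representation.trivial ℂ ↥(torusU (conjLocal L (IsCMField.complexConj L) v) (cmLocalForm L 3 v)) ℂ).twist (cmTorusCharPair L v χ₁ χ₂)).comp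
          (cmBorelTriple L 3 v).proj) (rootDeltaChar (cmBorelTriple L 3 v).P))),
      f₁ ∈ (cmPrincipalSeries L 3 v (cmTorusCharPair L v χ₁ χ₂)).fixedPoints I → f_w ∈ (cmPrincipalSeries L 3 v (cmTorusCharPair L v χ₁ χ₂)).fixedPoints I →
      f₁.toFun 1 = 1 →
      f₁.toFun (eA.symm (weylLongU (galAdicCompletionMap (L := L) (IsCMField.complexConj L) hw) (rfl : (StdForm.antidiagonal 3).over (w.1.adicCompletion L) = _))) = 0 →
      f_w.toFun 1 = 0 →
      f_w.toFun (eA.symm (weylLongU (galAdicCompletionMap (L := L) (IsCMField.complexConj L) hw) (rfl : (StdForm.antidiagonal 3).over (w.1.adicCompletion L) = _))) = 1 →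
      ∃ u : Representation.SmoothInd (cmBorelTriple L 3 v).P
          (Representation.twist (((Representation.trivial ℂ ↥(torusU (conjLocal L (IsCMField.complexConj L) v) (cmLocalForm L 3 v)) ℂ).twist (cmTorusCharPair L v χ₁ χ₂)).comp
            (cmBorelTriple L 3 v).proj) (rootDeltaChar (cmBorelTriple L 3 v).P)),
        u ≠ 0 ∧ u ∈ N.toSubmodule ∧ u ∈ Submodule.span ℂ ({f₁, f_w} : Set _) ∧
        ∀ u' ∈ N.toSubmodule, u' ∈ Submodule.span ℂ ({f₁, f_w} : Set _) → ∃ t : ℂ, u' = t • u := by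
  haveI := locallyCompactSpace_cmBorelU L 3 v
  intro f₁ f_w hf₁ hf_w h11 h1w hw1 hww
  -- ★ II-3: a non-zero `I`-fixed vector of `N`
  obtain ⟨u, huN, huI, hu0⟩ := K2E3IwahoriLinePF.exists_ne_zero_mem_inf_fixedPoints_I L v w hw eA heA hns hϖ g₁ hg₁ K0 K1 I hK0 hK1 hI χ₁ χ₂ h₁ h₂ hU N hbot htop
  -- ★ II-1: `V^I ⊆ ℂ f₁ ⊕ ℂ f_w`
  have hVI : ∀ f, f ∈ (cmPrincipalSeries L 3 v (cmTorusCharPair L v χ₁ χ₂)).fixedPoints I → f ∈ Submodule.span ℂ ({f₁, f_w} : Set _) := by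
    intro f hf
    rw [K2E3PSIwahoriBasisPF.eq_of_mem_fixedPoints_I L v w hw eA heA hϖ g₁ hg₁ K0 K1 I hK0 hK1 hI (cmTorusCharPair L v χ₁ χ₂) f₁ f_w f hf₁ hf_w hf h11 h1w hw1 hww,
      Submodule.mem_span_pair]
    exact ⟨_, _, rfl⟩
  -- `f₁, f_w` independent (values at `1`, `w̃`)
  have hlin : LinearIndependent ℂ ![f₁, f_w] := by
    refine LinearIndependent.pair_iff.2 fun s t hst => ?_
    have h0 : (0 : Representation.SmoothInd (cmBorelTriple L 3 v).P
        (Representation.twist (((Representation.trivial ℂ ↥(torusU (conjLocal L (IsCMField.complexConj L) v) (cmLocalForm L 3 v)) ℂ).twist (cmTorusCharPair L v χ₁ χ₂)).comp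
          (cmBorelTriple L 3 v).proj) (rootDeltaChar (cmBorelTriple L 3 v).P))).toFun = 0 := by
      have h := Representation.SmoothInd.toFun_smul (0 : ℂ) f₁
      rw [zero_smul] at h
      rw [h, zero_smul]
    have h0' : ∀ g, (0 : Representation.SmoothInd (cmBorelTriple L 3 v).P
        (Representation.twist (((Representation.trivial ℂ ↥(torusU (conjLocal L (IsCMField.complexConj L) v) (cmLocalForm L 3 v)) ℂ).twist (cmTorusCharPair L v χ₁ χ₂)).comp
          (cmBorelTriple L 3 v).proj) (rootDeltaChar (cmBorelTriple L 3 v).P))).toFun g = 0 := fun g => by rw [h0]; rfl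
    have e1 : (s • f₁ + t • f_w).toFun 1 = (0 : Representation.SmoothInd (cmBorelTriple L 3 v).P
        (Representation.twist (((Representation.trivial ℂ ↥(torusU (conjLocal L (IsCMField.complexConj L) v) (cmLocalForm L 3 v)) ℂ).twist (cmTorusCharPair L v χ₁ χ₂)).comp
          (cmBorelTriple L 3 v).proj) (rootDeltaChar (cmBorelTriple L 3 v).P))).toFun 1 := by rw [hst]
    have ew : (s • f₁ + t • f_w).toFun (eA.symm (weylLongU (galAdicCompletionMap (L := L) (IsCMField.complexConj L) hw) (rfl : (StdForm.antidiagonal 3).over (w.1.adicCompletion L) = _))) =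
        (0 : Representation.SmoothInd (cmBorelTriple L 3 v).P
        (Representation.twist (((Representation.trivial ℂ ↥(torusU (conjLocal L (IsCMField.complexConj L) v) (cmLocalForm L 3 v)) ℂ).twist (cmTorusCharPair L v χ₁ χ₂)).comp
          (cmBorelTriple L 3 v).proj) (rootDeltaChar (cmBorelTriple L 3 v).P))).toFun
          (eA.symm (weylLongU (galAdicCompletionMap (L := L) (IsCMField.complexConj L) hw) (rfl : (StdForm.antidiagonal 3).over (w.1.adicCompletion L) = _))) := by rw [hst]
    rw [h0', Representation.SmoothInd.toFun_add, Representation.SmoothInd.toFun_smul, Representation.SmoothInd.toFun_smul,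
      Pi.add_apply, Pi.smul_apply, Pi.smul_apply] at e1 ew
    rw [h11, hw1, smul_eq_mul, smul_eq_mul, mul_one, mul_zero, add_zero] at e1
    rw [h1w, hww, smul_eq_mul, smul_eq_mul, mul_zero, mul_one, zero_add] at ew
    exact ⟨e1, ew⟩
  -- ★-filed II-3′: the plane is not inside `N`
  have hS : ¬ Submodule.span ℂ ({f₁, f_w} : Set _) ≤ N.toSubmodule := by
    intro hle
    refine K2E3IwahoriLinePF.not_fixedPoints_I_le L v w hw eA heA hns hϖ g₁ hg₁ K0 K1 I hK0 hK1 hI χ₁ χ₂ h₁ h₂ hreg hU hUw N htop fun f hf => hle (hVI f hf)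
  refine ⟨u, hu0, huN, hVI u huI, fun u' hu'N hu'P => exists_eq_smul_of_not_le hlin N.toSubmodule hS hu0 huN (hVI u huI) hu'N hu'P⟩

end Summit.HodgeConjecture.HodgeConjecture.Cruxes.H413.K2E3IwahoriLinePF

end
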